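import Literature.MathematicalPhysics.QuantumManyBody.TorusAutocorrelationKernel
import Literature.MathematicalPhysics.QuantumManyBody.TorusTentKernel
import Literature.MathematicalPhysics.QuantumManyBody.PeriodicCondensateCoherence
import Literature.MathematicalPhysics.QuantumManyBody.PeriodicCoherenceFunction
import Literature.MathematicalPhysics.QuantumManyBody.PeriodicKineticBudget
import HarnessLib

/-!
# The zero mode of `log g` for one positive periodic state (infrared chain, steps (i)–(v))

Topic `Literature/MathematicalPhysics/QuantumManyBody`, namespace `BoseGas`. The per-state core of
the infrared route to Bose–Einstein condensation of dilute periodic minimisers ([Stringari1995, §2.2],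
[PitaevskiiStringari1991], [MoraCastin2003, §4.3]: the Lévy/phase weights `ν_m = Re ĉ_m(log g)` of
the translation-averaged coherence `g` control `n₀/N = L⁻³∫_cell g ≥ 1 + ν₀`), with ALL limits
removed and every constant explicit:

* `log_coherence_zero_mode_ge` — for a nowhere-vanishing periodic state `Ψ` of `n+1` bosons on
  the torus of side `L` with `n + 1 = ρL³`, `ρ = s²`, assume the local coherence bound
  `g(y) ≥ 1 - τ‖y‖²` on `ℝ³`, the quadratic structure-factor floor
  `min(½, |k_m|²/(16C_Fρ)) ≤ S_m` and the Lévy bound `(n+1)ν_mS_m ≤ C_I` (`m ≠ 0`); then for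
  `0 < d₀ ≤ 1` with `d₀/(Ls) ≤ 1` and `3τ(2d₀/s)² ≤ ¼`:
  **`ν₀ ≥ -1/3 - s·C_I(16 + 136C_F)/d₀³`.**
  Proof: pair `log g`, transported to `(ℝ/ℤ)³`, with the autocorrelation of the tent of radius
  `δ = d₀/(Ls)` (`autocorr_zero_mode_bound`); on its support `g ≥ ¾` by the local bound carried
  around the lattice (`periodic_lower_bound_near_lattice`), so the pairing is `≥ log(¾)(∫θ)²`;
  the non-zero modes are bounded through the floor and the Lévy bound (`levy_le_of_floor`), the
  infrared lattice sum in `d = 3` (`weighted_infrared_sum_le`) and Parseval for the tent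
  (`zero_mode_error_budget`);
* `condensateOccupation_eq_ofReal_integral_coherence` — step (i) in Bochner form,
  `⟨Ψ,n₀Ψ⟩ = ofReal((n+1)L⁻³∫_cell g)` for a real non-negative state.

## References

* S. Stringari, in *Bose–Einstein Condensation*, CUP 1995, §2.2. [`Stringari1995`]
* L. Pitaevskii, S. Stringari, J. Low Temp. Phys. 85 (1991) 377. [`PitaevskiiStringari1991`]
* C. Mora, Y. Castin, Phys. Rev. A 67 (2003) 053615, §4.3. [`MoraCastin2003`]
* E. H. Lieb, R. Seiringer, J. P. Solovej, J. Yngvason, *The Mathematics of the Bose Gas and its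
  Condensation*, Birkhäuser 2005, §1.2, Ch. 5. [`LSSY2005`]
-/

noncomputable section

open MeasureTheory Filter Set WithLp Complex UnitAddTorus
open scoped ENNReal NNReal ComplexConjugate

namespace Literature.MathematicalPhysics.QuantumManyBody.BoseGas

-- The measure on `ℝ/ℤ` is the Haar probability measure: the LOCAL instances of
-- `PeriodicConfigFourier.lean` (definitionally those of `Mathlib.Analysis.Fourier.AddCircleMulti`
-- and `PeriodicBoseGasFourier.lean`), re-activated locally; nothing is declared.
attribute [local instance] configFourier_measureSpace configFourier_isProbabilityMeasure
  configFourier_isProbabilityMeasure_pi configFourier_isAddLeftInvariant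
  configFourier_isAddLeftInvariant_pi

section ZeroMode

variable {n : ℕ} {L : ℝ}

/-- `log(3/4) ≥ -1/3` (from `log x ≤ x - 1` at `x = 4/3`). [folklore] -/
theorem neg_third_le_log_three_quarters : -(1 / 3 : ℝ) ≤ Real.log (3 / 4) := by
  have h := Real.log_le_sub_one_of_pos (show (0 : ℝ) < 4 / 3 by norm_num)
  have : Real.log (3 / 4) = -Real.log (4 / 3) := by
    rw [← Real.log_inv]; norm_num
  rw [this]; linarith

/-- **The zero-mode inequality for one positive state** (steps (iii)–(v) of the infrared chain,
all limits removed). Let `Ψ` be a nowhere-vanishing periodic state of `n+1` bosons on the torus of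
side `L`, `g` its translation-averaged coherence (explicit double integral), `ν_m = Re ĉ_m(log g)`
and `S_m = (n+1)⁻¹∫|∑ⱼe_m(xⱼ)|²|Ψ|²`. Assume `g(y) ≥ 1 - τ‖y‖²` for all `y ∈ ℝ³`, the floor
`min(½, |k_m|²/(16C_Fρ)) ≤ S_m` and the Lévy bound `(n+1)ν_mS_m ≤ C_I` for `m ≠ 0`, with
`n + 1 = ρL³`, `ρ = s²`. Then for every `0 < d₀ ≤ 1` with `d₀/(Ls) ≤ 1` and `3τ(2d₀/s)² ≤ ¼`:
`ν₀ ≥ -1/3 - s·C_I(16 + 136C_F)/d₀³`. [cite: Stringari1995, §2.2; MoraCastin2003, §4.3] -/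
theorem log_coherence_zero_mode_ge (hL : 0 < L) (Ψ : PeriodicTrialState (n + 1) L)
    (hpos : ∀ X, Ψ.ψ X ≠ 0) {C_F C_I ρ s d₀ τ : ℝ} (hCF : 0 < C_F) (hCI : 0 ≤ C_I)
    (hρ : 0 < ρ) (hs : 0 < s) (hsρ : s ^ 2 = ρ) (hd₀ : 0 < d₀) (hd₀1 : d₀ ≤ 1)
    (hNρ : ((n : ℝ) + 1) = ρ * L ^ 3) (hδ1 : d₀ / (L * s) ≤ 1) (hτ : 0 ≤ τ)
    (hτd : 3 * τ * (2 * d₀ / s) ^ 2 ≤ 1 / 4)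
    (hlow : ∀ y : Space, 1 - τ * ‖y‖ ^ 2 ≤ ∫ x in cell L, ∫ Y in cellN n L,
      ‖Ψ.ψ (Matrix.vecCons (x + y) Y)‖ * ‖Ψ.ψ (Matrix.vecCons x Y)‖)
    (hfloor : ∀ m : Fin 3 → ℤ, m ≠ 0 →
      min (1 / 2 : ℝ) (‖(2 * Real.pi / L) • latticeVec 1 m‖ ^ 2 / (16 * C_F * ρ)) ≤
        ((n : ℝ) + 1)⁻¹ *
          ∫ X in cellN (n + 1) L, ‖∑ j : Fin (n + 1), cellWave L m (X j)‖ ^ 2 * ‖Ψ.ψ X‖ ^ 2)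
    (hI : ∀ m : Fin 3 → ℤ, m ≠ 0 →
      ((n : ℝ) + 1) *
        (cellFourierCoeff L (fun r : Space => ((Real.log (∫ x in cell L, ∫ Y in cellN n L,
          ‖Ψ.ψ (Matrix.vecCons (x + r) Y)‖ * ‖Ψ.ψ (Matrix.vecCons x Y)‖) : ℝ) : ℂ)) m).re *
        (((n : ℝ) + 1)⁻¹ *
          ∫ X in cellN (n + 1) L, ‖∑ j : Fin (n + 1), cellWave L m (X j)‖ ^ 2 * ‖Ψ.ψ X‖ ^ 2) ≤ C_I) :
    -(1 / 3 : ℝ) - s * (C_I * (16 + 136 * C_F) / d₀ ^ 3) ≤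
      (cellFourierCoeff L (fun r : Space => ((Real.log (∫ x in cell L, ∫ Y in cellN n L,
        ‖Ψ.ψ (Matrix.vecCons (x + r) Y)‖ * ‖Ψ.ψ (Matrix.vecCons x Y)‖) : ℝ) : ℂ)) 0).re := by
  -- the coherence and its logarithm
  set g : Space → ℝ := fun r => ∫ x in cell L, ∫ Y in cellN n L,
    ‖Ψ.ψ (Matrix.vecCons (x + r) Y)‖ * ‖Ψ.ψ (Matrix.vecCons x Y)‖ with hgdef
  have hgc : Continuous g := continuous_coherenceFun hL Ψ
  have hg0 : ∀ r, 0 < g r := fun r => coherenceFun_pos hL Ψ hpos r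
  have hgper : ∀ (y : Space) (k : Fin 3), g (y + EuclideanSpace.single k L) = g y :=
    fun y k => coherenceFun_add_single Ψ y k
  set f : Space → ℂ := fun r => ((Real.log (g r) : ℝ) : ℂ) with hfdef
  have hfc : Continuous f := continuous_ofReal_log hgc fun r => (hg0 r).ne'
  have hF : MemLp (torusFun L f) 2 (volume : Measure (UnitAddTorus (Fin 3))) := memLp_torusFun hL hfc
  -- the tent and its mass
  set δ : ℝ := d₀ / (L * s) with hδdef
  have hδ : 0 < δ := by positivity
  set θ : UnitAddTorus (Fin 3) → ℝ := fun t => ∏ i, max 0 (1 - ‖t i‖ / δ) with hθdef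
  have hθc : Continuous θ := continuous_torusTent δ
  have hθ0 : ∀ t, 0 ≤ θ t := torusTent_nonneg δ
  set A : ℝ := ∫ t, θ t with hAdef
  have hA : d₀ ^ 3 / (8 * L ^ 3 * s ^ 3) ≤ A := by
    have h := integral_torusTent_ge (d := Fin 3) hδ hδ1
    rw [Fintype.card_fin] at h
    convert h using 1
    rw [hδdef]; field_simp; norm_num
  have hA0 : 0 < A := lt_of_lt_of_le (by positivity) hA
  -- weights
  have hw0 : ∀ m, 0 ≤ ‖mFourierCoeff (fun t => ((θ t : ℝ) : ℂ)) m‖ ^ 2 := fun m => by positivity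
  have hwA : ∀ m, ‖mFourierCoeff (fun t => ((θ t : ℝ) : ℂ)) m‖ ^ 2 ≤ A ^ 2 :=
    fun m => sq_norm_mFourierCoeff_le hθ0 m
  have hwB : ∀ S : Finset (Fin 3 → ℤ), ∑ m ∈ S, ‖mFourierCoeff (fun t => ((θ t : ℝ) : ℂ)) m‖ ^ 2 ≤ A :=
    fun S => (sum_sq_norm_mFourierCoeff_le hθc S).trans (integral_torusTent_sq_le hδ)
  -- the error budget
  set E : ℝ := A ^ 2 * (s * (C_I * (16 + 136 * C_F) / d₀ ^ 3)) with hEdef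
  have hmain := autocorr_zero_mode_bound (d := Fin 3) hθc hθ0 hF (γ := -(1 / 3 : ℝ)) (E := E) ?_ ?_
  · -- conclude by dividing by `A²`
    have hA2 : 0 < A ^ 2 := by positivity
    have : (-(1 / 3 : ℝ) - s * (C_I * (16 + 136 * C_F) / d₀ ^ 3)) * A ^ 2 ≤
        (mFourierCoeff (torusFun L f) 0).re * A ^ 2 := by
      rw [hEdef] at hmain; nlinarith [hmain]
    exact le_of_mul_le_mul_right this hA2
  · -- the support condition: on `supp Φ`, `g ≥ 3/4`
    intro t ht
    obtain ⟨u, hu1, hu2⟩ := exists_of_autocorr_ne_zero ht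
    have hti : ∀ i, ‖t i‖ < 2 * δ := by
      intro i
      have h1 := norm_lt_of_torusTent_ne_zero hδ hu1 i
      have h2 := norm_lt_of_torusTent_ne_zero hδ hu2 i
      calc ‖t i‖ = ‖(t + u) i - u i‖ := by simp
        _ ≤ ‖(t + u) i‖ + ‖u i‖ := norm_sub_le _ _
        _ < 2 * δ := by linarith
    set x : Space := fromUnitTorus L t with hxdef
    have htx : toUnitTorus L x = t := toUnitTorus_fromUnitTorus hL.ne' t
    have hx : ∀ i, ‖toUnitTorus L x i‖ < 2 * δ := by rw [htx]; exact hti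
    have hlow' : ∀ y : Space, 1 - τ * ‖y‖ ^ 2 ≤ g y := hlow
    have hgx := periodic_lower_bound_near_lattice hL hτ hgper hlow' hx
    have h34 : (3 / 4 : ℝ) ≤ g x := by
      have : 2 * δ * L = 2 * d₀ / s := by rw [hδdef]; field_simp
      rw [this] at hgx
      linarith
    show -(1 / 3 : ℝ) ≤ (f x).re
    simp only [hfdef, Complex.ofReal_re]
    exact neg_third_le_log_three_quarters.trans (Real.log_le_log (by norm_num) h34)
  · -- the non-zero modes
    intro S hS
    have hN : 0 < (n : ℝ) + 1 := by positivity
    -- termwise Lévy bound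
    have hterm : ∀ m ∈ S, ‖mFourierCoeff (fun t => ((θ t : ℝ) : ℂ)) m‖ ^ 2 *
        (mFourierCoeff (torusFun L f) m).re ≤
        ‖mFourierCoeff (fun t => ((θ t : ℝ) : ℂ)) m‖ ^ 2 *
          (C_I / ((n : ℝ) + 1) * (2 + 16 * C_F * ρ / ‖(2 * Real.pi / L) • latticeVec 1 m‖ ^ 2)) := by
      intro m hm
      have hm0 : m ≠ 0 := fun h => hS (h ▸ hm)
      refine mul_le_mul_of_nonneg_left ?_ (hw0 m)
      exact levy_le_of_floor hN hCF hCI hρ (normSq_waveVec_pos' hL hm0) (hfloor m hm0) (hI m hm0)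
    refine (Finset.sum_le_sum hterm).trans ?_
    have hsplit : ∑ m ∈ S, ‖mFourierCoeff (fun t => ((θ t : ℝ) : ℂ)) m‖ ^ 2 *
        (C_I / ((n : ℝ) + 1) * (2 + 16 * C_F * ρ / ‖(2 * Real.pi / L) • latticeVec 1 m‖ ^ 2)) =
        C_I / ((n : ℝ) + 1) * (2 * ∑ m ∈ S, ‖mFourierCoeff (fun t => ((θ t : ℝ) : ℂ)) m‖ ^ 2 +
          16 * C_F * ρ * ∑ m ∈ S, ‖mFourierCoeff (fun t => ((θ t : ℝ) : ℂ)) m‖ ^ 2 *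
            (‖(2 * Real.pi / L) • latticeVec 1 m‖ ^ 2)⁻¹) := by
      rw [Finset.mul_sum, Finset.mul_sum, mul_add, Finset.mul_sum, Finset.mul_sum, ← Finset.sum_add_distrib]
      refine Finset.sum_congr rfl fun m _ => ?_
      ring
    rw [hsplit]
    have hir := weighted_infrared_sum_le hw0 hwA hwB hL hs S hS
    calc C_I / ((n : ℝ) + 1) * (2 * ∑ m ∈ S, ‖mFourierCoeff (fun t => ((θ t : ℝ) : ℂ)) m‖ ^ 2 +
          16 * C_F * ρ * ∑ m ∈ S, ‖mFourierCoeff (fun t => ((θ t : ℝ) : ℂ)) m‖ ^ 2 *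
            (‖(2 * Real.pi / L) • latticeVec 1 m‖ ^ 2)⁻¹)
        ≤ C_I / ((n : ℝ) + 1) * (2 * A + 16 * C_F * ρ *
            (A ^ 2 * (96 * (s * L ^ 3 / (2 * Real.pi) ^ 3)) + s⁻¹ ^ 2 * A)) := by
          gcongr
          · exact hwB S
      _ = C_I / (s ^ 2 * L ^ 3) * (2 * A + 16 * C_F * s ^ 2 *
            (A ^ 2 * (96 * (s * L ^ 3 / (2 * Real.pi) ^ 3)) + s⁻¹ ^ 2 * A)) := by
          rw [hNρ, ← hsρ]
      _ ≤ E := zero_mode_error_budget hCI hCF hd₀ hd₀1 hs hL hA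

/-- **Step (i) of the chain, Bochner form**: the condensate occupation of a real non-negative
periodic state is `ofReal((n+1) L⁻³ ∫_cell g(r) dr)` with `g` its translation-averaged coherence.
[cite: LSSY2005, §1.2 (1.17); Stringari1995, §2] -/
theorem condensateOccupation_eq_ofReal_integral_coherence (hL : 0 < L)
    (Ψ : PeriodicTrialState (n + 1) L) (hreal : ∀ X, Ψ.ψ X = (‖Ψ.ψ X‖ : ℂ)) :
    condensateOccupation (n + 1) L Ψ.ψ = ENNReal.ofReal (((n : ℝ) + 1) * ((L ^ 3)⁻¹ *
      ∫ r in cell L, ∫ x in cell L, ∫ Y in cellN n L,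
        ‖Ψ.ψ (Matrix.vecCons (x + r) Y)‖ * ‖Ψ.ψ (Matrix.vecCons x Y)‖)) := by
  rw [condensateOccupation_eq_lintegral_coherence hL Ψ hreal]
  simp_rw [lintegral_slicePairing_eq_ofReal hL Ψ]
  have hg := continuous_coherenceFun hL Ψ
  rw [← ofReal_integral_eq_lintegral_ofReal (integrableOn_cell hg)
    (Eventually.of_forall fun r => integral_nonneg fun x => integral_nonneg fun Y => by positivity)]
  have hI : 0 ≤ ∫ r in cell L, ∫ x in cell L, ∫ Y in cellN n L,
      ‖Ψ.ψ (Matrix.vecCons (x + r) Y)‖ * ‖Ψ.ψ (Matrix.vecCons x Y)‖ :=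
    integral_nonneg fun r => integral_nonneg fun x => integral_nonneg fun Y => by positivity
  rw [ENNReal.ofReal_mul (by positivity), ENNReal.ofReal_mul (by positivity),
    ← ENNReal.ofReal_pow hL.le, ENNReal.ofReal_inv_of_pos (by positivity)]
  congr 1
  rw [show ((n : ℝ) + 1) = ((n + 1 : ℕ) : ℝ) by push_cast; ring, ENNReal.ofReal_natCast]
  push_cast
  rfl

end ZeroMode

end Literature.MathematicalPhysics.QuantumManyBody.BoseGas

end
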